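import Summits.Ventures.PercRepro.RankLevelSetDepCountMultA

/-!
# PercRepro — THE `U`-COUNT WITH MULTIPLICITY: EVERY RANK-`q` SET OF `m` ELEMENTS CONTAINS `≥ m − q` PAIRS
(night-1, gen 4; feeder lemma for the sub-claims S2 / S3, RULING (ug))

`proofs/NIGHT-1-C025-induction.md` §15.17. In the split count every pair `(C, B')` is charged its whole fibre
`{B : C ∪ B' ⊆ B ⊆ cl(C ∪ B'), |B| ≤ d}`, and a set `B` is counted once for EVERY pair inside it. A dependent set `B` of
rank `q` and `m` elements contains at least `m − q` pairs of rank `q`: for a basis `B₀` of `B` and each `x ∈ B ∖ B₀` the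
fundamental circuit `C_x` of `x` in `B₀` with `B'_x = (B₀ ∪ {x}) ∖ C_x`. Double counting the fibres of exact size `m`
therefore gives (`ncard_eRk_eq_ncard_eq_mul_le`)

  `(m − q) · #{B ⊆ E : r(B) = q, |B| = m} ≤ C(f' − q, m − q − 1) · Σ_k s_k·C(n, q+1−k) + C(f − q − 1, m − q − 1) · Σ_k s_k·C((q+1)d, q+1−k)`,

the weighted form of the split count (`ncard_eRk_eq_ncard_le_le_split` is the same right side without the factor `m − q`,
summed over `m`). With `ncard_eRk_eq_ncard_le_le_sum` (the union over the sizes) an assembly may use the weights `1/(m − q)`.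
Axioms: standard.
-/

open scoped Matroid

namespace PercRepro

namespace Matroid

open Set

variable {α : Type} {M : _root_.Matroid α}

/-- **THE WEIGHTED `U`-COUNT**: with every circuit of `≥ 3` elements, every set of rank `≤ q` of `≤ f` points, every set of
rank `≤ q − 1` of `≤ f'` points and `|E| = r(M) + d`, for every `m` (trivial for `m ≤ q`):
`(m − q) · #{B ⊆ E : r(B) = q, |B| = m} ≤ C(f' − q, m − q − 1) · Σ_k s_k·C(n, q+1−k) + C(f − q − 1, m − q − 1) · Σ_k s_k·C((q+1)d, q+1−k)`. -/
theorem ncard_eRk_eq_ncard_eq_mul_le (M : _root_.Matroid α) [M.Finite] (q f f' : ℕ) (hq : 1 ≤ q)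
    (hcirc : ∀ C, M.IsCircuit C → 3 ≤ C.encard)
    (hflat : ∀ X ⊆ M.E, M.eRk X ≤ q → X.ncard ≤ f)
    (hflat' : ∀ X ⊆ M.E, M.eRk X ≤ (q - 1 : ℕ) → X.ncard ≤ f') {d : ℕ} (hd : M.E.encard = M.eRank + d)
    (m : ℕ) :
    (m - q) * {B : Set α | B ⊆ M.E ∧ M.eRk B = q ∧ B.ncard = m}.ncard ≤
      Nat.choose (f' - q) (m - (q + 1)) *
          (∑ k ∈ Finset.Icc 3 (q + 1),
            {C | M.IsCircuit C ∧ C.ncard = k}.ncard * M.E.ncard.choose (q + 1 - k)) +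
        Nat.choose (f - (q + 1)) (m - (q + 1)) *
          (∑ k ∈ Finset.Icc 3 (q + 1),
            {C | M.IsCircuit C ∧ C.ncard = k}.ncard * ((q + 1) * d).choose (q + 1 - k)) := by
  classical
  set Ef := M.ground_finite.toFinset with hEf
  have hE : (Ef : Set α) = M.E := Set.Finite.coe_toFinset _
  have hEcard : Ef.card = M.E.ncard := (Set.ncard_eq_toFinset_card _ M.ground_finite).symm
  -- the union of the short circuits
  set S₀ := ⋃₀ circuitsLE M (q + 1) with hS₀
  have hS₀E : S₀ ⊆ M.E := by
    intro x hx
    obtain ⟨C, hC, hxC⟩ := mem_sUnion.1 hx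
    exact subset_ground_of_mem_circuitsLE hC hxC
  have hS₀fin : S₀.Finite := M.ground_finite.subset hS₀E
  set Sf := hS₀fin.toFinset with hSf
  have hScard : Sf.card ≤ (q + 1) * d := by
    have h := encard_sUnion_circuitsLE_le (M := M) (k := q + 1) (d := d) hd
    rw [← hS₀fin.cast_ncard_eq, Set.ncard_eq_toFinset_card _ hS₀fin] at h
    exact_mod_cast h
  -- the sets of size `m`
  set U := {B : Set α | B ⊆ M.E ∧ M.eRk B = q ∧ B.ncard = m} with hU
  have hUfin : U.Finite := M.ground_finite.finite_subsets.subset (fun B hB => hB.1)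
  set Uf := hUfin.toFinset with hUf
  have hUfcard : Uf.card = U.ncard := (Set.ncard_eq_toFinset_card _ hUfin).symm
  have hmemUf : ∀ B, B ∈ Uf ↔ B ⊆ M.E ∧ M.eRk B = q ∧ B.ncard = m := by
    intro B; rw [hUf, Set.Finite.mem_toFinset]; exact Iff.rfl
  -- the circuits of each size, the subsets of `E` and of `S₀` of each size
  have hcircfin : ∀ k : ℕ, {C | M.IsCircuit C ∧ C.ncard = k}.Finite := fun k =>
    M.ground_finite.finite_subsets.subset (fun C hC => hC.1.subset_ground)
  set 𝒞 : ℕ → Finset (Set α) := fun k => (hcircfin k).toFinset with h𝒞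
  set 𝓑 : ℕ → Finset (Set α) := fun j => (Ef.powersetCard j).image (fun s : Finset α => (s : Set α)) with h𝓑
  set 𝓑S : ℕ → Finset (Set α) := fun j => (Sf.powersetCard j).image (fun s : Finset α => (s : Set α)) with h𝓑S
  have h𝓑card : ∀ j, (𝓑 j).card ≤ M.E.ncard.choose j := by
    intro j
    calc (𝓑 j).card ≤ (Ef.powersetCard j).card := Finset.card_image_le
      _ = Ef.card.choose j := Finset.card_powersetCard j Ef
      _ = M.E.ncard.choose j := by rw [hEcard]
  have h𝓑Scard : ∀ j, (𝓑S j).card ≤ ((q + 1) * d).choose j := by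
    intro j
    calc (𝓑S j).card ≤ (Sf.powersetCard j).card := Finset.card_image_le
      _ = Sf.card.choose j := Finset.card_powersetCard j Sf
      _ ≤ ((q + 1) * d).choose j := Nat.choose_le_choose j hScard
  have h𝒞card : ∀ k, (𝒞 k).card = {C | M.IsCircuit C ∧ C.ncard = k}.ncard := fun k =>
    (Set.ncard_eq_toFinset_card _ (hcircfin k)).symm
  have hmem𝓑 : ∀ (j : ℕ) (B' : Set α), B' ⊆ M.E → B'.ncard = j → B' ∈ 𝓑 j := by
    intro j B' hB'E hB'
    have hB'fin : B'.Finite := M.ground_finite.subset hB'E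
    rw [h𝓑, Finset.mem_image]
    refine ⟨hB'fin.toFinset, ?_, by simp⟩
    rw [Finset.mem_powersetCard]
    refine ⟨?_, by rw [← Set.ncard_eq_toFinset_card B' hB'fin]; exact hB'⟩
    intro x hx
    rw [Set.Finite.mem_toFinset] at hx
    rw [hEf, Set.Finite.mem_toFinset]
    exact hB'E hx
  have hmem𝓑S : ∀ (j : ℕ) (B' : Set α), B' ⊆ S₀ → B'.ncard = j → B' ∈ 𝓑S j := by
    intro j B' hB'S hB'
    have hB'fin : B'.Finite := hS₀fin.subset hB'S
    rw [h𝓑S, Finset.mem_image]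
    refine ⟨hB'fin.toFinset, ?_, by simp⟩
    rw [Finset.mem_powersetCard]
    refine ⟨?_, by rw [← Set.ncard_eq_toFinset_card B' hB'fin]; exact hB'⟩
    intro x hx
    rw [Set.Finite.mem_toFinset] at hx
    rw [hSf, Set.Finite.mem_toFinset]
    exact hB'S hx
  -- the pairs OF RANK EXACTLY `q`
  set P : Finset (Set α × Set α) :=
    ((Finset.Icc 3 (q + 1)).biUnion (fun k => 𝒞 k ×ˢ 𝓑 (q + 1 - k))).filter
      (fun p => Disjoint p.2 p.1 ∧ M.eRk (p.1 ∪ p.2) = q) with hP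
  set Psmall := P.filter (fun p => (M.closure (p.1 ∪ p.2)).ncard ≤ f' + 1) with hPsmall
  set Pbig := P.filter (fun p => ¬ (M.closure (p.1 ∪ p.2)).ncard ≤ f' + 1) with hPbig
  -- the data of a pair
  have hpair : ∀ p ∈ P, p.1 ⊆ M.E ∧ p.2 ⊆ M.E ∧ (p.1 ∪ p.2).ncard = q + 1 ∧ M.eRk (p.1 ∪ p.2) = q ∧
      ∃ k, k ∈ Finset.Icc 3 (q + 1) ∧ p.1 ∈ 𝒞 k ∧ p.2.ncard = q + 1 - k := by
    intro p hp
    rw [hP, Finset.mem_filter] at hp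
    obtain ⟨hpmem, hdisj, hrk⟩ := hp
    rw [Finset.mem_biUnion] at hpmem
    obtain ⟨k, hk, hpk⟩ := hpmem
    rw [Finset.mem_product] at hpk
    obtain ⟨h1, h2⟩ := hpk
    have h1' := h1
    rw [h𝒞, Set.Finite.mem_toFinset] at h1'
    rw [h𝓑, Finset.mem_image] at h2
    obtain ⟨s, hs, hs'⟩ := h2
    rw [Finset.mem_powersetCard] at hs
    have hp1E : p.1 ⊆ M.E := h1'.1.subset_ground
    have hp2E : p.2 ⊆ M.E := by rw [← hs', ← hE]; exact Finset.coe_subset.2 hs.1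
    have hp1fin : p.1.Finite := M.ground_finite.subset hp1E
    have hp2fin : p.2.Finite := M.ground_finite.subset hp2E
    have hp1c : p.1.ncard = k := h1'.2
    have hp2c : p.2.ncard = q + 1 - k := by rw [← hs', Set.ncard_coe_finset]; exact hs.2
    rw [Finset.mem_Icc] at hk
    refine ⟨hp1E, hp2E, ?_, hrk, k, Finset.mem_Icc.2 hk, h1, hp2c⟩
    rw [ncard_union_eq hdisj.symm hp1fin hp2fin, hp1c, hp2c]
    omega
  -- (1) the fibre of a pair at size `m` is bounded by the exact-size fibre in `cl U`
  have hfib : ∀ p ∈ P, ∀ m', (M.closure (p.1 ∪ p.2) \ (p.1 ∪ p.2)).ncard ≤ m' →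
      (Uf.filter (fun B => p.1 ∪ p.2 ⊆ B)).card ≤ Nat.choose m' (m - (q + 1)) := by
    intro p hp m' hm'
    obtain ⟨hp1E, hp2E, hU', hrk, -⟩ := hpair p hp
    have hUE : p.1 ∪ p.2 ⊆ M.E := union_subset hp1E hp2E
    have hFfin : (M.closure (p.1 ∪ p.2)).Finite :=
      M.ground_finite.subset (M.closure_subset_ground _)
    have hsub : ((Uf.filter (fun B => p.1 ∪ p.2 ⊆ B)) : Set (Set α)) ⊆
        {B : Set α | p.1 ∪ p.2 ⊆ B ∧ B ⊆ M.closure (p.1 ∪ p.2) ∧ B.ncard = m} := by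
      intro B hB
      rw [Finset.mem_coe, Finset.mem_filter, hmemUf] at hB
      exact ⟨hB.2, subset_closure_of_eRk_eq hB.2 hB.1.1 hrk hB.1.2.1, hB.1.2.2⟩
    calc (Uf.filter (fun B => p.1 ∪ p.2 ⊆ B)).card
        = ((Uf.filter (fun B => p.1 ∪ p.2 ⊆ B)) : Set (Set α)).ncard := (Set.ncard_coe_finset _).symm
      _ ≤ {B : Set α | p.1 ∪ p.2 ⊆ B ∧ B ⊆ M.closure (p.1 ∪ p.2) ∧ B.ncard = m}.ncard :=
          ncard_le_ncard hsub (hFfin.finite_subsets.subset (fun B hB => hB.2.1))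
      _ ≤ Nat.choose m' (m - (q + 1)) := ncard_fibre_eq_le hFfin hU' hm' m
  have hfib_small : ∀ p ∈ Psmall,
      (Uf.filter (fun B => p.1 ∪ p.2 ⊆ B)).card ≤ Nat.choose (f' - q) (m - (q + 1)) := by
    intro p hp
    rw [hPsmall, Finset.mem_filter] at hp
    obtain ⟨hpP, hsmall⟩ := hp
    obtain ⟨hp1E, hp2E, hU', hrk, -⟩ := hpair p hpP
    have hUE : p.1 ∪ p.2 ⊆ M.E := union_subset hp1E hp2E
    have hFfin : (M.closure (p.1 ∪ p.2)).Finite :=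
      M.ground_finite.subset (M.closure_subset_ground _)
    have hUF : p.1 ∪ p.2 ⊆ M.closure (p.1 ∪ p.2) := M.subset_closure _ hUE
    refine hfib p hpP _ ?_
    rw [ncard_sdiff hUF (hFfin.subset hUF), hU']
    omega
  have hfib_big : ∀ p ∈ Pbig,
      (Uf.filter (fun B => p.1 ∪ p.2 ⊆ B)).card ≤ Nat.choose (f - (q + 1)) (m - (q + 1)) := by
    intro p hp
    rw [hPbig, Finset.mem_filter] at hp
    obtain ⟨hpP, -⟩ := hp
    obtain ⟨hp1E, hp2E, hU', hrk, -⟩ := hpair p hpP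
    have hUE : p.1 ∪ p.2 ⊆ M.E := union_subset hp1E hp2E
    have hFfin : (M.closure (p.1 ∪ p.2)).Finite :=
      M.ground_finite.subset (M.closure_subset_ground _)
    have hFf : (M.closure (p.1 ∪ p.2)).ncard ≤ f :=
      hflat _ (M.closure_subset_ground _) (by rw [M.eRk_closure_eq, hrk])
    have hUF : p.1 ∪ p.2 ⊆ M.closure (p.1 ∪ p.2) := M.subset_closure _ hUE
    refine hfib p hpP _ ?_
    rw [ncard_sdiff hUF (hFfin.subset hUF), hU']
    omega
  -- (2) the big pairs live inside `S₀`
  have hPbig_sub : Pbig ⊆ (Finset.Icc 3 (q + 1)).biUnion (fun k => 𝒞 k ×ˢ 𝓑S (q + 1 - k)) := by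
    intro p hp
    rw [hPbig, Finset.mem_filter] at hp
    obtain ⟨hpP, hbig⟩ := hp
    push Not at hbig
    obtain ⟨hp1E, hp2E, hU', hrk, k, hk, h1, hp2c⟩ := hpair p hpP
    have hUE : p.1 ∪ p.2 ⊆ M.E := union_subset hp1E hp2E
    have hsub : M.closure (p.1 ∪ p.2) ⊆ S₀ :=
      big_flat_subset_sUnion_circuitsLE hq hflat' hrk.le hbig
    have hUF : p.1 ∪ p.2 ⊆ M.closure (p.1 ∪ p.2) := M.subset_closure _ hUE
    rw [Finset.mem_biUnion]
    refine ⟨k, hk, ?_⟩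
    rw [Finset.mem_product]
    exact ⟨h1, hmem𝓑S _ p.2 ((subset_union_right.trans hUF).trans hsub) hp2c⟩
  -- (3) the number of pairs
  have hPcard : P.card ≤
      ∑ k ∈ Finset.Icc 3 (q + 1), {C | M.IsCircuit C ∧ C.ncard = k}.ncard * M.E.ncard.choose (q + 1 - k) := by
    calc P.card ≤ ((Finset.Icc 3 (q + 1)).biUnion (fun k => 𝒞 k ×ˢ 𝓑 (q + 1 - k))).card :=
          Finset.card_filter_le _ _
      _ ≤ ∑ k ∈ Finset.Icc 3 (q + 1), (𝒞 k ×ˢ 𝓑 (q + 1 - k)).card := Finset.card_biUnion_le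
      _ ≤ ∑ k ∈ Finset.Icc 3 (q + 1), {C | M.IsCircuit C ∧ C.ncard = k}.ncard * M.E.ncard.choose (q + 1 - k) := by
          apply Finset.sum_le_sum
          intro k _
          rw [Finset.card_product, h𝒞card k]
          exact Nat.mul_le_mul_left _ (h𝓑card _)
  have hPbigcard : Pbig.card ≤
      ∑ k ∈ Finset.Icc 3 (q + 1), {C | M.IsCircuit C ∧ C.ncard = k}.ncard * ((q + 1) * d).choose (q + 1 - k) := by
    calc Pbig.card ≤ ((Finset.Icc 3 (q + 1)).biUnion (fun k => 𝒞 k ×ˢ 𝓑S (q + 1 - k))).card :=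
          Finset.card_le_card hPbig_sub
      _ ≤ ∑ k ∈ Finset.Icc 3 (q + 1), (𝒞 k ×ˢ 𝓑S (q + 1 - k)).card := Finset.card_biUnion_le
      _ ≤ ∑ k ∈ Finset.Icc 3 (q + 1), {C | M.IsCircuit C ∧ C.ncard = k}.ncard * ((q + 1) * d).choose (q + 1 - k) := by
          apply Finset.sum_le_sum
          intro k _
          rw [Finset.card_product, h𝒞card k]
          exact Nat.mul_le_mul_left _ (h𝓑Scard _)
  have hPsmallcard : Psmall.card ≤ P.card := Finset.card_filter_le _ _
  -- (4) every `B ∈ Uf` contains at least `m − q` pairs of `P`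
  have hlow : ∀ B ∈ Uf, m - q ≤ (P.filter (fun p => p.1 ∪ p.2 ⊆ B)).card := by
    intro B hB
    rw [hmemUf] at hB
    obtain ⟨hBE, hBr, hBm⟩ := hB
    have hBfin : B.Finite := M.ground_finite.subset hBE
    obtain ⟨I, hI⟩ := M.exists_isBasis B hBE
    have hIB : I ⊆ B := hI.subset
    have hIfin : I.Finite := hBfin.subset hIB
    have hIcard : I.ncard = q := by
      have h := hI.encard_eq_eRk
      rw [hBr, ← hIfin.cast_ncard_eq] at h
      exact_mod_cast h
    have hIrk : M.eRk I = q := by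
      rw [hI.indep.eRk_eq_encard, ← hIfin.cast_ncard_eq, hIcard]
    have hBI : (B \ I).ncard = m - q := by
      rw [ncard_sdiff hIB hIfin, hBm, hIcard]
    have hBIfin : (B \ I).Finite := hBfin.subset sdiff_subset
    -- the pair of `x ∈ B ∖ I`
    set pr : α → Set α × Set α := fun x =>
      (M.fundCircuit x I, insert x I \ M.fundCircuit x I) with hpr
    have hpr_union : ∀ x ∈ B \ I, (pr x).1 ∪ (pr x).2 = insert x I := by
      intro x _
      simp only [hpr]
      exact union_sdiff_cancel (M.fundCircuit_subset_insert x I)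
    have hmaps : ∀ x ∈ hBIfin.toFinset, pr x ∈ P.filter (fun p => p.1 ∪ p.2 ⊆ B) := by
      intro x hx
      rw [Set.Finite.mem_toFinset] at hx
      have hxB : x ∈ B := hx.1
      have hxI : x ∉ I := hx.2
      have hxcl : x ∈ M.closure I := hI.subset_closure hxB
      have hC : M.IsCircuit (M.fundCircuit x I) := hI.indep.fundCircuit_isCircuit hxcl hxI
      have hCsub : M.fundCircuit x I ⊆ insert x I := M.fundCircuit_subset_insert x I
      have hxIB : insert x I ⊆ B := insert_subset hxB hIB
      have hxIfin : (insert x I).Finite := hBfin.subset hxIB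
      have hxIcard : (insert x I).ncard = q + 1 := by
        rw [ncard_insert_of_notMem hxI hIfin, hIcard]
      have hCfin : (M.fundCircuit x I).Finite := hxIfin.subset hCsub
      have hC3 : 3 ≤ (M.fundCircuit x I).ncard := by
        have := hcirc _ hC
        rw [← hCfin.cast_ncard_eq] at this
        exact_mod_cast this
      have hCle : (M.fundCircuit x I).ncard ≤ q + 1 := by
        rw [← hxIcard]; exact ncard_le_ncard hCsub hxIfin
      have hB'card : (insert x I \ M.fundCircuit x I).ncard = q + 1 - (M.fundCircuit x I).ncard := by
        rw [ncard_sdiff hCsub hCfin, hxIcard]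
      have hrk : M.eRk (insert x I) = q := by
        apply le_antisymm
        · rw [← hBr]; exact M.eRk_mono hxIB
        · rw [← hIrk]; exact M.eRk_mono (subset_insert x I)
      rw [Finset.mem_filter, hP, Finset.mem_filter]
      refine ⟨⟨?_, ?_, ?_⟩, ?_⟩
      · rw [Finset.mem_biUnion]
        refine ⟨(M.fundCircuit x I).ncard, ?_, ?_⟩
        · rw [Finset.mem_Icc]; exact ⟨hC3, hCle⟩
        · rw [Finset.mem_product]
          refine ⟨?_, hmem𝓑 _ _ (sdiff_subset.trans (hxIB.trans hBE)) hB'card⟩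
          rw [h𝒞, Set.Finite.mem_toFinset]; exact ⟨hC, rfl⟩
      · exact disjoint_sdiff_left
      · rw [hpr_union x hx]; exact hrk
      · rw [hpr_union x hx]; exact hxIB
    have hinj : Set.InjOn pr (hBIfin.toFinset : Set α) := by
      intro x hx y hy hxy
      rw [Finset.mem_coe, Set.Finite.mem_toFinset] at hx hy
      have h1 : (pr x).1 ∪ (pr x).2 = (pr y).1 ∪ (pr y).2 := by rw [hxy]
      rw [hpr_union x hx, hpr_union y hy] at h1
      have h2 : x ∈ insert y I := by rw [← h1]; exact mem_insert x I
      rcases h2 with h2 | h2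
      · exact h2
      · exact absurd h2 hx.2
    calc m - q = (hBIfin.toFinset).card := by
          rw [← Set.ncard_eq_toFinset_card _ hBIfin, hBI]
      _ ≤ (P.filter (fun p => p.1 ∪ p.2 ⊆ B)).card := Finset.card_le_card_of_injOn pr hmaps hinj
  -- (5) the double count: `Σ_{B ∈ Uf} #{p ∈ P : p ⊆ B} = Σ_{p ∈ P} #{B ∈ Uf : p ⊆ B}`
  have hdouble : ∑ B ∈ Uf, (P.filter (fun p => p.1 ∪ p.2 ⊆ B)).card =
      ∑ p ∈ P, (Uf.filter (fun B => p.1 ∪ p.2 ⊆ B)).card := by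
    simp only [Finset.card_filter]
    exact Finset.sum_comm
  -- assemble
  have hleft : (m - q) * Uf.card ≤ ∑ B ∈ Uf, (P.filter (fun p => p.1 ∪ p.2 ⊆ B)).card := by
    calc (m - q) * Uf.card = ∑ _B ∈ Uf, (m - q) := by rw [Finset.sum_const, smul_eq_mul, mul_comm]
      _ ≤ ∑ B ∈ Uf, (P.filter (fun p => p.1 ∪ p.2 ⊆ B)).card := Finset.sum_le_sum hlow
  have hright : ∑ p ∈ P, (Uf.filter (fun B => p.1 ∪ p.2 ⊆ B)).card ≤
      Nat.choose (f' - q) (m - (q + 1)) * P.card + Nat.choose (f - (q + 1)) (m - (q + 1)) * Pbig.card := by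
    have hsum : ∑ p ∈ P, (Uf.filter (fun B => p.1 ∪ p.2 ⊆ B)).card =
        ∑ p ∈ Psmall, (Uf.filter (fun B => p.1 ∪ p.2 ⊆ B)).card +
          ∑ p ∈ Pbig, (Uf.filter (fun B => p.1 ∪ p.2 ⊆ B)).card := by
      rw [hPsmall, hPbig]
      exact (Finset.sum_filter_add_sum_filter_not P _ _).symm
    rw [hsum]
    calc ∑ p ∈ Psmall, (Uf.filter (fun B => p.1 ∪ p.2 ⊆ B)).card +
          ∑ p ∈ Pbig, (Uf.filter (fun B => p.1 ∪ p.2 ⊆ B)).card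
        ≤ ∑ _p ∈ Psmall, Nat.choose (f' - q) (m - (q + 1)) +
            ∑ _p ∈ Pbig, Nat.choose (f - (q + 1)) (m - (q + 1)) :=
          add_le_add (Finset.sum_le_sum hfib_small) (Finset.sum_le_sum hfib_big)
      _ = Psmall.card * Nat.choose (f' - q) (m - (q + 1)) + Pbig.card * Nat.choose (f - (q + 1)) (m - (q + 1)) := by
          rw [Finset.sum_const, smul_eq_mul, Finset.sum_const, smul_eq_mul]
      _ ≤ _ := by
          rw [mul_comm Psmall.card, mul_comm Pbig.card]
          exact add_le_add (Nat.mul_le_mul_left _ hPsmallcard) le_rfl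
  rw [← hUfcard]
  calc (m - q) * Uf.card ≤ ∑ B ∈ Uf, (P.filter (fun p => p.1 ∪ p.2 ⊆ B)).card := hleft
    _ = ∑ p ∈ P, (Uf.filter (fun B => p.1 ∪ p.2 ⊆ B)).card := hdouble
    _ ≤ Nat.choose (f' - q) (m - (q + 1)) * P.card + Nat.choose (f - (q + 1)) (m - (q + 1)) * Pbig.card := hright
    _ ≤ _ := add_le_add (Nat.mul_le_mul_left _ hPcard) (Nat.mul_le_mul_left _ hPbigcard)

end Matroid

end PercRepro
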